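import Summits.Ventures.PercRepro.S2TopFiveHit
import Summits.Ventures.PercRepro.S2TopHitSeven

/-!
# PercRepro — S2: THE TOP `6`-SETS THROUGH A TRIANGLE AT CORANK `7` (p7, gen 14; sub-claim S2; the spread case of `(14, 7)`)

At corank `7` a top `6`-set `B` (`ρ(B) = 5`, `E ∖ B` spanning) through a triangle `T` is `T ∪ X` with `X` a `3`-subset of
`E ∖ T`, and `B` meets the union `D₁ ∪ D₂` of any two distinct circuits (`S2.top_six_inter_union_nonempty`); for `D₁`, `D₂`
avoiding `T` the set `X` does. So **`ncard_top_six_through_add_le`**: `#{top 6-sets through T} + C(|(E ∖ T) ∖ (D₁ ∪ D₂)|, 3)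
≤ C(|E ∖ T|, 3)` — at `(14, 7)` with Lemma A′'s two circuits (`|D₁ ∪ D₂| ≥ 5`, **`five_le_ncard_union_of_circuits_le_four`**)
the charge of a triangle is `≤ C(18, 3) − C(13, 3) = 816 − 286 = 530`. Axioms: standard.
-/

open scoped Matroid

namespace PercRepro

namespace S2

open Set

variable {α : Type}

/-- **The top `6`-sets through a triangle at corank `7`**, counted against the `3`-subsets of `E ∖ T` missing `D₁ ∪ D₂`. -/
theorem ncard_top_six_through_add_le (M : Matroid α) [M.Finite] {p : ℕ} (hR : M.eRank = (p : ℕ∞))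
    (hn : M.E.ncard = p + 7) {T D₁ D₂ : Set α} (hT : T ⊆ M.E) (hT3 : T.ncard = 3)
    (h₁ : M.IsCircuit D₁) (h₂ : M.IsCircuit D₂) (hne : D₁ ≠ D₂) (hd₁ : Disjoint D₁ T) (hd₂ : Disjoint D₂ T) :
    {B : Set α | B ⊆ M.E ∧ B.ncard = 6 ∧ T ⊆ B ∧ M.eRk (M.E \ B) = M.eRank}.ncard +
      ((M.E \ T) \ (D₁ ∪ D₂)).ncard.choose 3 ≤ (M.E \ T).ncard.choose 3 := by
  classical
  have hTfin : T.Finite := M.ground_finite.subset hT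
  have hZfin : (M.E \ T).Finite := M.ground_finite.sdiff
  have h := ncard_subsets_inter_nonempty_add_le (M.E \ T) (D₁ ∪ D₂) (D₁ ∪ D₂) hZfin 3
  rw [Set.union_self] at h
  have hhit := top_six_inter_union_nonempty M hR hn h₁ h₂ hne
  have hmaps : ∀ B ∈ {B : Set α | B ⊆ M.E ∧ B.ncard = 6 ∧ T ⊆ B ∧ M.eRk (M.E \ B) = M.eRank},
      (fun B : Set α => B \ T) B ∈
        {X : Set α | X ⊆ M.E \ T ∧ X.ncard = 3 ∧ (X ∩ (D₁ ∪ D₂)).Nonempty ∧ (X ∩ (D₁ ∪ D₂)).Nonempty} := by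
    rintro B ⟨hBE, hB6, hTB, hBs⟩
    have hX : ((B \ T) ∩ (D₁ ∪ D₂)).Nonempty := by
      obtain ⟨y, hyB, hyD⟩ := hhit B hBE hB6 hBs
      refine ⟨y, ⟨hyB, fun hyT => ?_⟩, hyD⟩
      rcases hyD with hyD | hyD
      · exact Set.disjoint_left.1 hd₁ hyD hyT
      · exact Set.disjoint_left.1 hd₂ hyD hyT
    refine ⟨sdiff_subset_sdiff_left hBE, ?_, hX, hX⟩
    rw [Set.ncard_sdiff hTB hTfin, hB6, hT3]
  have hinj : Set.InjOn (fun B : Set α => B \ T)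
      {B : Set α | B ⊆ M.E ∧ B.ncard = 6 ∧ T ⊆ B ∧ M.eRk (M.E \ B) = M.eRank} := by
    rintro B₁ ⟨-, -, hT₁, -⟩ B₂ ⟨-, -, hT₂, -⟩ hEq
    simp only at hEq
    rw [← Set.sdiff_union_of_subset hT₁, ← Set.sdiff_union_of_subset hT₂, hEq]
  have hle := Set.ncard_le_ncard_of_injOn _ hmaps hinj (hZfin.finite_subsets.subset (fun X hX => hX.1))
  omega

/-- **Every circuit has `≥ 3` points** on the free core (a loop lies in every closure; a pair has rank `2`). -/
theorem three_le_ncard_of_isCircuit_of_free (M : Matroid α) [M.Finite]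
    (hfree : ∀ e ∈ M.E, ∃ A ⊆ M.E \ {e}, e ∉ M.closure A ∧ e ∉ M.closure ((M.E \ {e}) \ A))
    {C : Set α} (hC : M.IsCircuit C) : 3 ≤ C.ncard := by
  have hCfin : C.Finite := M.ground_finite.subset hC.subset_ground
  by_contra hlt
  push Not at hlt
  obtain ⟨e, he⟩ := hC.nonempty
  have hpos : 0 < C.ncard := (Set.ncard_pos hCfin).2 ⟨e, he⟩
  rcases Nat.lt_or_ge C.ncard 2 with h1 | h2
  · -- `C = {e}`, a loop
    have h1' : C.ncard = 1 := by omega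
    obtain ⟨f, hf⟩ := Set.ncard_eq_one.1 h1'
    have hef : e = f := by rw [hf] at he; exact he
    subst hef
    rw [hf] at hC
    have hloop : M.IsLoop e := Matroid.singleton_isCircuit.1 hC
    obtain ⟨A, -, heA, -⟩ := hfree e hloop.mem_ground
    exact heA (hloop.mem_closure A)
  · -- `|C| = 2`: rank `2` makes it independent
    have h2' : C.ncard = 2 := by omega
    have hrk : (2 : ℕ∞) ≤ M.eRk C :=
      ThmN.two_le_eRk_of_two_le_ncard_of_free M hfree hC.subset_ground (by omega)
    have hind : M.Indep C := by
      rw [Matroid.indep_iff_eRk_eq_encard_of_finite hCfin, ← hCfin.cast_ncard_eq, h2']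
      exact le_antisymm (by
        have := M.eRk_le_encard C
        rwa [← hCfin.cast_ncard_eq, h2'] at this) hrk
    exact hC.not_indep hind

/-- **Two distinct circuits of size `≤ 4` have `≥ 5` points together** when no two triangles share a line and every
circuit has `≥ 3` points: neither contains the other, and two triangles meet in `≤ 1` point. -/
theorem five_le_ncard_union_of_circuits_le_four (M : Matroid α) [M.Finite]
    (hC1 : ∀ L ⊆ M.E, M.eRk L = 2 → L.ncard ≤ 3) (h3 : ∀ C, M.IsCircuit C → 3 ≤ C.ncard)
    {D₁ D₂ : Set α} (h₁ : M.IsCircuit D₁) (h₁c : D₁.ncard ≤ 4) (h₂ : M.IsCircuit D₂) (h₂c : D₂.ncard ≤ 4)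
    (hne : D₁ ≠ D₂) : 5 ≤ (D₁ ∪ D₂).ncard := by
  have h₁fin : D₁.Finite := M.ground_finite.subset h₁.subset_ground
  have h₂fin : D₂.Finite := M.ground_finite.subset h₂.subset_ground
  have hi := Set.ncard_union_add_ncard_inter D₁ D₂ h₁fin h₂fin
  -- the intersection is a proper subset of both
  have hlt₁ : (D₁ ∩ D₂).ncard < D₁.ncard := by
    refine Set.ncard_lt_ncard (Set.ssubset_iff_subset_ne.2 ⟨Set.inter_subset_left, fun heq => ?_⟩) h₁fin
    have hsub : D₁ ⊆ D₂ := by rw [← heq]; exact Set.inter_subset_right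
    exact hne (h₁.eq_of_subset_isCircuit h₂ hsub)
  have hlt₂ : (D₁ ∩ D₂).ncard < D₂.ncard := by
    refine Set.ncard_lt_ncard (Set.ssubset_iff_subset_ne.2 ⟨Set.inter_subset_right, fun heq => ?_⟩) h₂fin
    have hsub : D₂ ⊆ D₁ := by rw [← heq]; exact Set.inter_subset_left
    exact hne.symm (h₂.eq_of_subset_isCircuit h₁ hsub)
  have h₁3 := h3 D₁ h₁
  have h₂3 := h3 D₂ h₂
  rcases Nat.lt_or_ge 3 D₁.ncard with h4 | h3'
  · omega
  rcases Nat.lt_or_ge 3 D₂.ncard with h4 | h3''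
  · omega
  -- two triangles
  exact five_le_ncard_union_of_triangles M hC1 h₁ (by omega) h₂ (by omega) hne

end S2

end PercRepro
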